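import Summits.QuantumFields.BalabanUV.Beta.GAN24.WardResidualSRecursionAll
import Summits.QuantumFields.BalabanUV.Beta.KernelWardResidual
import Summits.QuantumFields.BalabanUV.Beta.SecondOrderLetterParity

/-!
# `BalabanUV.Beta.GAN24.WardResidualParity` — binder row G-an2-4 ∕ (CONV-C), CT-W route of record «WC-TL» ∕ (Q-R), the OWNER's exit (α) «use the identity, not its defect»
# (RULING R-lead-g77-1 (2), design note `CTW-DESIGN-ALPHA-v0.md` v0.3, INTERFACE REQUEST IR-α1 → gan24-p2):
# **THE WARD-LOCUS RESIDUAL IS ROW-PARITY-ODD AT EVERY LEVEL — the born Ward-defect letter `Ψ_j(y; e)`, the transported table tower `Φ_j(Y)`, hence every source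
# `σ_m = −c·Σ_v mmRead Lc (G_m ∘ Ψ_m ∘ G_m)` (which is therefore kernel-transpose-ANTISYMMETRIC: `σ_m^{sym} = 0` exactly — ENGINE E41 (i) as a theorem, in the strong form)
# and the full residual `vertexOfK G_j (Φ_j y) e + Ψ_j y e`, which is TADPOLE-NULL against every step propagator `G_i`**
# (G-an2-4 CRUX TEAM (2), seat `b2b-balaban-gan24-p2` = road-P2 chair, gen 44, INTENT 2; the typed answer to IR-α1 in the D1 lane's parity currency `trK X = −sgnK X`)

NOT IN PRINT; OUR BOOKKEEPING ([folklore] BY NAME over the shapes of road-P2 g37's `WardResidualSRecursionAll.exists_kernelLaws_vertexForm` ((Ψ), (Φ₀), (Φ-STEP), the per-level classes)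
and the D1 lane's parity toolkit: d1-formalise-leaf-05's `SpineRecursivePureParity.trK_SpureRecAt` (the unfolded field tables are row-parity-odd at every level),
`SpineRecursiveParity.{parityOdd_smul, parityOdd_neg, parityOdd_sum, parityOdd_sandwich, parityOdd_mmRead, trK_e3OfK_of_rows, parityOdd_dM, trK_M1At, loc_of_locStencil,
tadpole_stepProp_eq_zero_of_parity}`, an1's `KernelWardRemainderParity.{parityOdd_add, parityOdd_wsum, parityOdd_cwsum, trK_vertexOfK_eq_neg_sgnK_of_rows, trK_vertexOfM_eq_neg_sgnK_of_rows}`,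
an2's `BubbleParity.{trK_coDressKBmAt_KInvStep, spr_of_decays}`, `VertexSandwichTransport.loc_vertexOfK`; 0 `def`, 0 cited fact, 0 `def … : Prop`, 0 sorry).
HONEST FRAMING (cell contract, verbatim): «discharging `BetaPertH` makes Bałaban's UV stability UNCONDITIONAL — a real constructive-QFT result; it is NOT the continuum limit and NOT
the Clay problem.»  HONEST DEPENDENCY (verbatim): «continuum YM on T⁴ ⇐ BetaPertH ∧ nine spine estimates (0/9 proved); BetaPertH ⇐ (D1) ∧ (D4) ∧ CAP+tail; G-an2-4 gates asym,
D1 and NE2/3/4.»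

THE QUESTION (OWNER gan24-p1 g32∕g33, IR-α1): ENGINE E41 found the block-flux kernel of the born Ward-defect letter transpose-ANTISYMMETRIC in the two kernel gauges to 1e-11; the
design note conjectured `σ_m = σ_m^{sym} + σ_m^{anti}` with `σ_m^{anti}` «the commutator word» and `σ_m^{sym}` flux-free.  THE ANSWER FROM THE TREE's DEFINITIONS: in road-P2's (REP)
bookkeeping the Ward law reads `divW (WrecAt j) y e = conjV (dM G_j Lc S_j M_j e) (X_y) + (vertexOfK G_j (Φ_j y) e + Ψ_j y e)`; the commutator `conjV (dM …) X_y` is the identity's MAIN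
term and is parity-EVEN; the DEFECT `vertexOfK G_j (Φ_j y) e + Ψ_j y e` is parity-ODD IN ITS ENTIRETY, at every level, for every label and slot, as soon as the letters' remainders
`RW RW″ RB RB″ RM` are (at the literal of record they are `0`): `Ψ_j` is made of `dM`-words and `wsum ∕ cwsum`-superpositions of the rows of `S_j = SpureRecAt … j` and
`M_j = M1At … j`, all row-parity-odd (`trK_SpureRecAt`, `trK_M1At`) with SCALAR weights (`parityOdd_dM` for ANY weight kernel — the commutator `conjV G_j X_y` included —,
`parityOdd_wsum ∕ _cwsum`); `Φ_{j+1}` is the block-summed S-step `e3OfK G_j (Φ_j ·)` (`trK_e3OfK_of_rows`) plus the sandwiched sources `mmRead (G_j ∘ Ψ_j ∘ G_j)`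
(`parityOdd_sandwich` ⨾ `parityOdd_mmRead`, `G_j` spread and sgn-symmetric).  CONSEQUENCES: (i) every source `σ_m` is parity-odd, and being an `mmRead` (field–field block only)
it is PLAINLY transpose-antisymmetric: `σ_m^{sym} = 0`, not merely flux-free (E41 (i) exactly); (ii) the residual is TADPOLE-NULL against every `G_i`
(`tadpole_stepProp_eq_zero_of_parity`) — the (PAR) class of the D1 lane's `SecondOrderStepRemainderWall` and of the OWNER g33's junction `WSlotParityBlind` (the D1 END is blind
to parity-odd W-slot summands).  WHAT THIS DOES NOT DO: it does not say through which words of `WrecAt`'s recursion the residual `Φ_n` enters the W-slot table `W⁰_n μ 0 ν z`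
(IR-α0′); (Q-R) ∕ (LT) ∕ (DIV) ∕ (DL) ∕ «T2Shape» are NOT discharged; (β) of record untouched.
* §1 **`parityOdd_readVertex`** (the `wsum ∕ cwsum` superposition of row-parity-odd tables with ANY weights is parity-odd), `sgnK_mmRead` (an `mmRead` is
  sgn-invariant), `trK_mmRead_eq_neg_of_parityOdd` (a parity-odd `mmRead` is transpose-antisymmetric).
* §2 **`parityOdd_bornLetter`** — (Ψ)'s right-hand side is parity-odd at every `j y ν y′` (given `RM j y` row-parity-odd).
* §3 **`parityOdd_residual_tower`** — for ANY `Φ Ψ` with (Ψ), (Φ₀), (Φ-STEP), the per-level classes, and parity-odd remainders: (a) `trK (Ψ j y ν y′) = −sgnK (Ψ j y ν y′)`;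
  (b) `trK (Φ j Y κ u) = −sgnK (Φ j Y κ u)`; (c) the sources `mmRead Lc (G_m ∘ Ψ_m(Lc•Y+v) κ′u′ ∘ G_m)` are parity-odd AND transpose-antisymmetric; (d)
  `tadpole G_i (vertexOfK G_j Lc (Φ j y) ν y′ + Ψ j y ν y′) = 0` for all `i j y ν y′`.
* §4 **`parityOdd_residual_tower_literal`** — the literal of record (`RW = RW″ = 0`, `RB = RB″ = 0`, `RM = 0`): (a)–(d) with no parity hypothesis left.
Asserts NO bound, NO rate, NO value of any table; NEVER «G-an2-4 closed» as (CONV-C); NOT D1, NOT `BetaPertH`, NOT continuum, NOT Clay.  2026-08-23; no existing file touched.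
-/

noncomputable section

open Finset
open scoped BigOperators
open Literature.MathematicalPhysics.QuantumFieldTheory
open Literature.MathematicalPhysics.QuantumFieldTheory.Balaban1983to89
open Literature.MathematicalPhysics.QuantumFieldTheory.Balaban1983to89.Beta
open ExpKernelCalculus (MKer Decays VertexFamily comp tadpole)
open AffineAveraging (Site box toSite)
open OneStepResolventKernel (Fib wsum LocStencil)
open OneStepKernelFamily (KInvStep colH vertexOfK)
open InterLevelTransport (cwsum)
open BalabanStepJetsSucc (mmRead mmRead_inl_inl mmRead_inr_left mmRead_inr_right wE)
open SecondOrderResponse (colM vertexOfM dM)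
open Summit.QuantumFields.BalabanUV.Beta.TameKernelCalculus
open Summit.QuantumFields.BalabanUV.Beta.ChartConjugation (conjV)
open Summit.QuantumFields.BalabanUV.Beta.BorderedHessian (diagK stepScale sgnF sgnF_inl sgnF_inr sgnK sgnK_apply sgnK_sgnK trK_sgnK)
open KernelWard (divW)
open Summit.QuantumFields.BalabanUV.Beta.AveragingWardRootedStencils (legInd)
open Summit.QuantumFields.BalabanUV.Beta.AxialDressingRooted (coDressKBmAt decays_coDressKBmAt_KInvStep one_le_of_neZero)
open Summit.QuantumFields.BalabanUV.Beta.SpineRooted (SpureRecAt M1At e3OfK)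
open Summit.QuantumFields.BalabanUV.Beta.KernelWardRelative (gaugeWt)
open Summit.QuantumFields.BalabanUV.Beta.BubbleParity (trK_coDressKBmAt_KInvStep spr_of_decays sgnK_neg)
open Summit.QuantumFields.BalabanUV.Beta.VertexSandwichTransport (loc_vertexOfK)
open Summit.QuantumFields.BalabanUV.Beta.KernelWardRemainderParity (sgnK_add parityOdd_add parityOdd_wsum parityOdd_cwsum trK_vertexOfK_eq_neg_sgnK_of_rows trK_vertexOfM_eq_neg_sgnK_of_rows)
open Summit.QuantumFields.BalabanUV.Beta.SpineRecursiveParity (parityOdd_smul parityOdd_neg parityOdd_zero parityOdd_sum parityOdd_sandwich parityOdd_mmRead trK_e3OfK_of_rows parityOdd_dM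
  trK_M1At loc_of_locStencil tadpole_stepProp_eq_zero_of_parity)
open Summit.QuantumFields.BalabanUV.Beta.SpineRecursivePureParity (trK_SpureRecAt)
open Summit.QuantumFields.BalabanUV.Beta.KernelWardResidual (parityOdd_sub)
open Summit.QuantumFields.BalabanUV.Beta.SecondOrderLetterParity (parityEven_conjV_diagK_of_odd)

namespace Summit.QuantumFields.BalabanUV.Beta.GAN24.WardResidualParity

variable {d : ℕ}

/-! ## §1 Closure helpers -/

/-- [folklore] **THE READ-WEIGHTED VERTEX IS PARITY-ODD**: a `wsum`-superposition of the rows of a row-parity-odd field table `S` plus a `cwsum`-superposition of the rows of a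
row-parity-odd multiplier table `M`, with ANY scalar weights, is parity-odd (`parityOdd_wsum ∕ _cwsum ∕ _sum ∕ _add`). -/
theorem parityOdd_readVertex (N : ℕ) {S M : Fin (d + 1) → (Fin (d + 1) → ℤ) → MKer (d + 1) (Fib d)}
    (hS : ∀ κ u, trK (S κ u) = -sgnK (S κ u)) (hM : ∀ ρ w, trK (M ρ w) = -sgnK (M ρ w))
    (w : Fin (d + 1) → (Fin (d + 1) → ℤ) → ℝ) (w' : Fin (d + 1) → (Fin (d + 1) → ℤ) → ℝ) :
    trK (∑ κ, wsum (w κ) (S κ) + ∑ ρ', cwsum N (w' ρ') (M ρ')) = -sgnK (∑ κ, wsum (w κ) (S κ) + ∑ ρ', cwsum N (w' ρ') (M ρ')) :=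
  parityOdd_add (parityOdd_sum _ fun κ _ => parityOdd_wsum (w κ) (hS κ)) (parityOdd_sum _ fun ρ' _ => parityOdd_cwsum (w' ρ') (hM ρ'))

/-- [folklore] An `mmRead` is supported on the field–field block, so `sgnK` fixes it. -/
theorem sgnK_mmRead (M : ℕ) (F : MKer (d + 1) (Fib d)) : sgnK (mmRead M F) = mmRead M F := by
  funext x z a b
  rcases a with α | μ <;> rcases b with β | ν
  · rw [sgnK_apply, sgnF_inl, sgnF_inl, one_mul, one_mul]
  · rw [sgnK_apply, mmRead_inr_right, mul_zero]
  · rw [sgnK_apply, mmRead_inr_left, mul_zero]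
  · rw [sgnK_apply, mmRead_inr_left, mul_zero]

/-- [folklore] **A PARITY-ODD `mmRead` IS PLAINLY TRANSPOSE-ANTISYMMETRIC**: `trK (mmRead M F) = −mmRead M F`. -/
theorem trK_mmRead_eq_neg_of_parityOdd (M : ℕ) {F : MKer (d + 1) (Fib d)} (h : trK (mmRead M F) = -sgnK (mmRead M F)) :
    trK (mmRead M F) = -mmRead M F := by
  rw [h, sgnK_mmRead]

/-! ## §2 The born Ward-defect letter is parity-odd -/

section Born

variable {Lc : ℕ} [NeZero Lc]

/-- NOT IN PRINT; OUR BOOKKEEPING.  **THE BORN WARD-DEFECT LETTER IS ROW-PARITY-ODD** (in-block root `toSite r`, every `j y ν y′`, any `cΛ`): the right-hand side of (Ψ) in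
`WardResidualSRecursionAll.exists_kernelLaws_vertexForm` — `vertexOfM G_j (RM j y) + ½ • dM (conjV G_j X_y) Lc S_j M_j − c_j • (read-weighted vertex of S_j, M_j)` — is parity-odd as
soon as the multiplier-letter remainder `RM j y` is row-parity-odd (`parityOdd_dM` for ANY weight kernel, `trK_SpureRecAt`, `trK_M1At`, §1). -/
theorem parityOdd_bornLetter (hLc : 1 ≤ Lc) {r : Fin (d + 1) → ℕ} (hr : r ∈ box (d + 1) Lc) (cΛ : ℝ)
    {RM : ℕ → (Fin (d + 1) → ℤ) → Fin (d + 1) → (Fin (d + 1) → ℤ) → MKer (d + 1) (Fib d)}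
    (hRM : ∀ j y ρ w, trK (RM j y ρ w) = -sgnK (RM j y ρ w)) (j : ℕ) (y : Fin (d + 1) → ℤ) (ν : Fin (d + 1)) (y' : Fin (d + 1) → ℤ) :
    trK (vertexOfM (coDressKBmAt (toSite r) Lc (KInvStep (d := d) Lc j)) Lc (RM j y) ν y'
        + (1 / 2 : ℝ) • (dM (conjV (coDressKBmAt (toSite r) Lc (KInvStep (d := d) Lc j))
                (diagK (((1 : ℝ) / 2) • ∑ v ∈ box (d + 1) Lc, legInd (toSite r) ((Lc : ℤ) • y + toSite v)))) Lc
              (SpureRecAt d Lc (toSite r) ((Lc : ℝ) ^ (d + 1)) (-((Lc : ℝ) ^ (d + 1) * (1 / 2) * (Lc : ℝ) ^ (d + 1))) cΛ j)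
              (M1At d Lc (toSite r) cΛ j) ν y'
          - (stepScale d Lc j * (Lc : ℝ) ^ (d + 1))⁻¹ • (∑ κ, wsum (fun u => ∑' x₂, ∑ κ₂,
              comp (coDressKBmAt (toSite r) Lc (KInvStep (d := d) Lc j))
                (dM (coDressKBmAt (toSite r) Lc (KInvStep (d := d) Lc j)) Lc
                  (SpureRecAt d Lc (toSite r) ((Lc : ℝ) ^ (d + 1)) (-((Lc : ℝ) ^ (d + 1) * (1 / 2) * (Lc : ℝ) ^ (d + 1))) cΛ j)
                  (M1At d Lc (toSite r) cΛ j) ν y') u x₂ (Sum.inl κ) (Sum.inl κ₂) * gaugeWt Lc y κ₂ x₂)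
              (SpureRecAt d Lc (toSite r) ((Lc : ℝ) ^ (d + 1)) (-((Lc : ℝ) ^ (d + 1) * (1 / 2) * (Lc : ℝ) ^ (d + 1))) cΛ j κ)
            + ∑ ρ', cwsum Lc (fun w => ∑' x₂, ∑ κ₂,
              comp (coDressKBmAt (toSite r) Lc (KInvStep (d := d) Lc j))
                (dM (coDressKBmAt (toSite r) Lc (KInvStep (d := d) Lc j)) Lc
                  (SpureRecAt d Lc (toSite r) ((Lc : ℝ) ^ (d + 1)) (-((Lc : ℝ) ^ (d + 1) * (1 / 2) * (Lc : ℝ) ^ (d + 1))) cΛ j)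
                  (M1At d Lc (toSite r) cΛ j) ν y') ((Lc : ℤ) • w) x₂ (Sum.inr ρ') (Sum.inl κ₂) * gaugeWt Lc y κ₂ x₂)
              (M1At d Lc (toSite r) cΛ j ρ'))))
      = -sgnK (vertexOfM (coDressKBmAt (toSite r) Lc (KInvStep (d := d) Lc j)) Lc (RM j y) ν y'
        + (1 / 2 : ℝ) • (dM (conjV (coDressKBmAt (toSite r) Lc (KInvStep (d := d) Lc j))
                (diagK (((1 : ℝ) / 2) • ∑ v ∈ box (d + 1) Lc, legInd (toSite r) ((Lc : ℤ) • y + toSite v)))) Lc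
              (SpureRecAt d Lc (toSite r) ((Lc : ℝ) ^ (d + 1)) (-((Lc : ℝ) ^ (d + 1) * (1 / 2) * (Lc : ℝ) ^ (d + 1))) cΛ j)
              (M1At d Lc (toSite r) cΛ j) ν y'
          - (stepScale d Lc j * (Lc : ℝ) ^ (d + 1))⁻¹ • (∑ κ, wsum (fun u => ∑' x₂, ∑ κ₂,
              comp (coDressKBmAt (toSite r) Lc (KInvStep (d := d) Lc j))
                (dM (coDressKBmAt (toSite r) Lc (KInvStep (d := d) Lc j)) Lc
                  (SpureRecAt d Lc (toSite r) ((Lc : ℝ) ^ (d + 1)) (-((Lc : ℝ) ^ (d + 1) * (1 / 2) * (Lc : ℝ) ^ (d + 1))) cΛ j)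
                  (M1At d Lc (toSite r) cΛ j) ν y') u x₂ (Sum.inl κ) (Sum.inl κ₂) * gaugeWt Lc y κ₂ x₂)
              (SpureRecAt d Lc (toSite r) ((Lc : ℝ) ^ (d + 1)) (-((Lc : ℝ) ^ (d + 1) * (1 / 2) * (Lc : ℝ) ^ (d + 1))) cΛ j κ)
            + ∑ ρ', cwsum Lc (fun w => ∑' x₂, ∑ κ₂,
              comp (coDressKBmAt (toSite r) Lc (KInvStep (d := d) Lc j))
                (dM (coDressKBmAt (toSite r) Lc (KInvStep (d := d) Lc j)) Lc
                  (SpureRecAt d Lc (toSite r) ((Lc : ℝ) ^ (d + 1)) (-((Lc : ℝ) ^ (d + 1) * (1 / 2) * (Lc : ℝ) ^ (d + 1))) cΛ j)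
                  (M1At d Lc (toSite r) cΛ j) ν y') ((Lc : ℤ) • w) x₂ (Sum.inr ρ') (Sum.inl κ₂) * gaugeWt Lc y κ₂ x₂)
              (M1At d Lc (toSite r) cΛ j ρ')))) := by
  have hS := trK_SpureRecAt (d := d) hLc hr ((Lc : ℝ) ^ (d + 1)) (-((Lc : ℝ) ^ (d + 1) * (1 / 2) * (Lc : ℝ) ^ (d + 1))) cΛ j
  have hM : ∀ ρ w, trK (M1At d Lc (toSite r) cΛ j ρ w) = -sgnK (M1At d Lc (toSite r) cΛ j ρ w) := fun ρ w => trK_M1At (toSite r) cΛ j ρ w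
  exact parityOdd_add (trK_vertexOfM_eq_neg_sgnK_of_rows _ (hRM j y) ν y')
    (parityOdd_smul _ (parityOdd_sub (parityOdd_dM _ Lc hS hM ν y') (parityOdd_smul _ (parityOdd_readVertex Lc hS hM _ _))))

end Born


/-! ## §3 The residual tower is parity-odd at every level; the sources are transpose-antisymmetric; the residual is tadpole-null -/

section Tower

variable {Lc : ℕ} [NeZero Lc]

/-- NOT IN PRINT; OUR BOOKKEEPING.  **THE WARD-LOCUS RESIDUAL IS ROW-PARITY-ODD AT EVERY LEVEL** (in-block root `toSite r`, any `cΛ`; ANY `Φ Ψ` with the shapes (Ψ), (Φ₀),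
(Φ-STEP) and the per-level classes of `WardResidualSRecursionAll.exists_kernelLaws_vertexForm`; the letters' remainders `RW RW″ RB RB″ RM` row-parity-odd — at the literal `0`,
`parityOdd_zero`): (a) `trK (Ψ j y ν y′) = −sgnK (Ψ j y ν y′)`; (b) `trK (Φ j Y κ u) = −sgnK (Φ j Y κ u)`; (c) every source `mmRead Lc (G_j ∘ Ψ_j(Lc•Y+v) κ′u′ ∘ G_j)` is
parity-odd AND plainly transpose-antisymmetric (`trK σ = −σ`: `σ^{sym} = 0`, ENGINE E41 (i) exactly); (d) `tadpole G_i (vertexOfK G_j Lc (Φ j y) ν y′ + Ψ j y ν y′) = 0` for all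
`i j y ν y′` — the residual is in the (PAR) class of the D1 lane's `SecondOrderStepRemainderWall` ∕ the OWNER g33's `WSlotParityBlind`.  (§2; induction on the level with
`trK_e3OfK_of_rows` and `parityOdd_sandwich ⨾ parityOdd_mmRead`, `Loc (Ψ j y e)` from the two classes; `tadpole_stepProp_eq_zero_of_parity`.) -/
theorem parityOdd_residual_tower (hLc : 1 ≤ Lc) {r : Fin (d + 1) → ℕ} (hr : r ∈ box (d + 1) Lc) (cΛ : ℝ)
    {RW RW'' : (Fin (d + 1) → ℤ) → Fin (d + 1) → (Fin (d + 1) → ℤ) → MKer (d + 1) (Fib d)}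
    {RB RB'' : ℕ → (Fin (d + 1) → ℤ) → Fin (d + 1) → (Fin (d + 1) → ℤ) → MKer (d + 1) (Fib d)}
    {RM : ℕ → (Fin (d + 1) → ℤ) → Fin (d + 1) → (Fin (d + 1) → ℤ) → MKer (d + 1) (Fib d)}
    (hRW : ∀ y κ u, trK (RW y κ u) = -sgnK (RW y κ u)) (hRW'' : ∀ y κ u, trK (RW'' y κ u) = -sgnK (RW'' y κ u))
    (hRB : ∀ j y κ u, trK (RB j y κ u) = -sgnK (RB j y κ u)) (hRB'' : ∀ j y κ u, trK (RB'' j y κ u) = -sgnK (RB'' j y κ u))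
    (hRM : ∀ j y ρ w, trK (RM j y ρ w) = -sgnK (RM j y ρ w))
    {Φ Ψ : ℕ → (Fin (d + 1) → ℤ) → Fin (d + 1) → (Fin (d + 1) → ℤ) → MKer (d + 1) (Fib d)}
    (hΨ : ∀ (j : ℕ) (y : Fin (d + 1) → ℤ) (ν : Fin (d + 1)) (y' : Fin (d + 1) → ℤ), Ψ j y ν y' =
        vertexOfM (coDressKBmAt (toSite r) Lc (KInvStep (d := d) Lc j)) Lc (RM j y) ν y'
        + (1 / 2 : ℝ) • (dM (conjV (coDressKBmAt (toSite r) Lc (KInvStep (d := d) Lc j))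
                (diagK (((1 : ℝ) / 2) • ∑ v ∈ box (d + 1) Lc, legInd (toSite r) ((Lc : ℤ) • y + toSite v)))) Lc
              (SpureRecAt d Lc (toSite r) ((Lc : ℝ) ^ (d + 1)) (-((Lc : ℝ) ^ (d + 1) * (1 / 2) * (Lc : ℝ) ^ (d + 1))) cΛ j)
              (M1At d Lc (toSite r) cΛ j) ν y'
          - (stepScale d Lc j * (Lc : ℝ) ^ (d + 1))⁻¹ • (∑ κ, wsum (fun u => ∑' x₂, ∑ κ₂,
              comp (coDressKBmAt (toSite r) Lc (KInvStep (d := d) Lc j))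
                (dM (coDressKBmAt (toSite r) Lc (KInvStep (d := d) Lc j)) Lc
                  (SpureRecAt d Lc (toSite r) ((Lc : ℝ) ^ (d + 1)) (-((Lc : ℝ) ^ (d + 1) * (1 / 2) * (Lc : ℝ) ^ (d + 1))) cΛ j)
                  (M1At d Lc (toSite r) cΛ j) ν y') u x₂ (Sum.inl κ) (Sum.inl κ₂) * gaugeWt Lc y κ₂ x₂)
              (SpureRecAt d Lc (toSite r) ((Lc : ℝ) ^ (d + 1)) (-((Lc : ℝ) ^ (d + 1) * (1 / 2) * (Lc : ℝ) ^ (d + 1))) cΛ j κ)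
            + ∑ ρ', cwsum Lc (fun w => ∑' x₂, ∑ κ₂,
              comp (coDressKBmAt (toSite r) Lc (KInvStep (d := d) Lc j))
                (dM (coDressKBmAt (toSite r) Lc (KInvStep (d := d) Lc j)) Lc
                  (SpureRecAt d Lc (toSite r) ((Lc : ℝ) ^ (d + 1)) (-((Lc : ℝ) ^ (d + 1) * (1 / 2) * (Lc : ℝ) ^ (d + 1))) cΛ j)
                  (M1At d Lc (toSite r) cΛ j) ν y') ((Lc : ℤ) • w) x₂ (Sum.inr ρ') (Sum.inl κ₂) * gaugeWt Lc y κ₂ x₂)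
              (M1At d Lc (toSite r) cΛ j ρ'))))
    (hΦ0 : Φ 0 = fun y κ u => (1 / 2 : ℝ) • ((RW y κ u + RB 0 y κ u) + (RW'' y κ u + RB'' 0 y κ u)))
    (hΦS : ∀ j : ℕ, Φ (j + 1) = fun Y κ' u' =>
        ∑ v ∈ box (d + 1) Lc, ((Lc : ℝ) ^ (d + 1) * wE d Lc (j + 1)) •
            e3OfK Lc (coDressKBmAt (toSite r) Lc (KInvStep (d := d) Lc j)) (Φ j ((Lc : ℤ) • Y + toSite v)) κ' u'
          + ((-((Lc : ℝ) ^ (d + 1) * wE d Lc (j + 1))) • ∑ v ∈ box (d + 1) Lc,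
                mmRead Lc (comp (comp (coDressKBmAt (toSite r) Lc (KInvStep (d := d) Lc j)) (Ψ j ((Lc : ℤ) • Y + toSite v) κ' u'))
                  (coDressKBmAt (toSite r) Lc (KInvStep (d := d) Lc j)))
            + (1 / 2 : ℝ) • (RB (j + 1) Y κ' u' + RB'' (j + 1) Y κ' u')))
    (hcls : ∀ j : ℕ, ∃ C δ : ℝ, 0 < δ ∧ ∀ y, LocStencil (Φ j y) C δ)
    (hres : ∀ j : ℕ, ∃ C δ : ℝ, 0 < δ ∧ ∀ y, VertexFamily (fun ν y' => vertexOfK (coDressKBmAt (toSite r) Lc (KInvStep (d := d) Lc j)) Lc (Φ j y) ν y' + Ψ j y ν y') Lc C δ) :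
    (∀ (j : ℕ) (y : Fin (d + 1) → ℤ) (ν : Fin (d + 1)) (y' : Fin (d + 1) → ℤ), trK (Ψ j y ν y') = -sgnK (Ψ j y ν y')) ∧
    (∀ (j : ℕ) (Y : Fin (d + 1) → ℤ) (κ : Fin (d + 1)) (u : Fin (d + 1) → ℤ), trK (Φ j Y κ u) = -sgnK (Φ j Y κ u)) ∧
    (∀ (j : ℕ) (Y : Fin (d + 1) → ℤ) (v : Fin (d + 1) → ℕ) (κ' : Fin (d + 1)) (u' : Fin (d + 1) → ℤ),
      trK (mmRead Lc (comp (comp (coDressKBmAt (toSite r) Lc (KInvStep (d := d) Lc j)) (Ψ j ((Lc : ℤ) • Y + toSite v) κ' u')) (coDressKBmAt (toSite r) Lc (KInvStep (d := d) Lc j))))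
          = -sgnK (mmRead Lc (comp (comp (coDressKBmAt (toSite r) Lc (KInvStep (d := d) Lc j)) (Ψ j ((Lc : ℤ) • Y + toSite v) κ' u')) (coDressKBmAt (toSite r) Lc (KInvStep (d := d) Lc j)))) ∧
      trK (mmRead Lc (comp (comp (coDressKBmAt (toSite r) Lc (KInvStep (d := d) Lc j)) (Ψ j ((Lc : ℤ) • Y + toSite v) κ' u')) (coDressKBmAt (toSite r) Lc (KInvStep (d := d) Lc j))))
          = -(mmRead Lc (comp (comp (coDressKBmAt (toSite r) Lc (KInvStep (d := d) Lc j)) (Ψ j ((Lc : ℤ) • Y + toSite v) κ' u')) (coDressKBmAt (toSite r) Lc (KInvStep (d := d) Lc j))))) ∧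
    (∀ (i j : ℕ) (y : Fin (d + 1) → ℤ) (ν : Fin (d + 1)) (y' : Fin (d + 1) → ℤ),
      tadpole (coDressKBmAt (toSite r) Lc (KInvStep (d := d) Lc i)) (vertexOfK (coDressKBmAt (toSite r) Lc (KInvStep (d := d) Lc j)) Lc (Φ j y) ν y' + Ψ j y ν y') = 0) := by
  have hspr : ∀ j : ℕ, Spr (coDressKBmAt (toSite r) Lc (KInvStep (d := d) Lc j)) := fun j => spr_of_decays (decays_coDressKBmAt_KInvStep hr j)
  have hGt : ∀ j : ℕ, trK (coDressKBmAt (toSite r) Lc (KInvStep (d := d) Lc j)) = sgnK (coDressKBmAt (toSite r) Lc (KInvStep (d := d) Lc j)) := fun j => trK_coDressKBmAt_KInvStep hr j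
  have hΨpar : ∀ (j : ℕ) (y : Fin (d + 1) → ℤ) (ν : Fin (d + 1)) (y' : Fin (d + 1) → ℤ), trK (Ψ j y ν y') = -sgnK (Ψ j y ν y') :=
    fun j y ν y' => by rw [hΨ j y ν y']; exact parityOdd_bornLetter hLc hr cΛ hRM j y ν y'
  have hΨloc : ∀ (j : ℕ) (y : Fin (d + 1) → ℤ) (ν : Fin (d + 1)) (y' : Fin (d + 1) → ℤ), Loc (Ψ j y ν y') := fun j y ν y' => by
    obtain ⟨C, δ, hδ, hV⟩ := hres j
    obtain ⟨Cs, δs, hδs, hS⟩ := hcls j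
    have h1 : Loc (vertexOfK (coDressKBmAt (toSite r) Lc (KInvStep (d := d) Lc j)) Lc (Φ j y) ν y' + Ψ j y ν y') := ⟨_, _, C, δ, hδ, hV y ν y'⟩
    have h2 : Loc (vertexOfK (coDressKBmAt (toSite r) Lc (KInvStep (d := d) Lc j)) Lc (Φ j y) ν y') := loc_vertexOfK (hspr j) (hS y) hδs ν y'
    have h3 := Loc.sub h1 h2
    rwa [add_sub_cancel_left] at h3
  have hΦpar : ∀ (j : ℕ) (Y : Fin (d + 1) → ℤ) (κ : Fin (d + 1)) (u : Fin (d + 1) → ℤ), trK (Φ j Y κ u) = -sgnK (Φ j Y κ u) := by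
    intro j
    induction j with
    | zero =>
      intro Y κ u
      simp only [hΦ0]
      exact parityOdd_smul _ (parityOdd_add (parityOdd_add (hRW Y κ u) (hRB 0 Y κ u)) (parityOdd_add (hRW'' Y κ u) (hRB'' 0 Y κ u)))
    | succ j ih =>
      intro Y κ' u'
      obtain ⟨Cs, δs, hδs, hS⟩ := hcls j
      simp only [hΦS j]
      refine parityOdd_add ?_ (parityOdd_add ?_ ?_)
      · exact parityOdd_sum _ fun v _ => parityOdd_smul _ (trK_e3OfK_of_rows (hspr j) (hGt j) (hS _) hδs (fun κ u => ih _ κ u) κ' u')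
      · exact parityOdd_smul _ (parityOdd_sum _ fun v _ =>
          parityOdd_mmRead Lc (parityOdd_sandwich (hspr j) (hΨloc j _ κ' u') (hGt j) (hΨpar j _ κ' u')))
      · exact parityOdd_smul _ (parityOdd_add (hRB (j + 1) Y κ' u') (hRB'' (j + 1) Y κ' u'))
  refine ⟨hΨpar, hΦpar, fun j Y v κ' u' => ?_, fun i j y ν y' => ?_⟩
  · have h := parityOdd_mmRead Lc (parityOdd_sandwich (hspr j) (hΨloc j ((Lc : ℤ) • Y + toSite v) κ' u') (hGt j) (hΨpar j ((Lc : ℤ) • Y + toSite v) κ' u'))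
    exact ⟨h, trK_mmRead_eq_neg_of_parityOdd Lc h⟩
  · obtain ⟨C, δ, hδ, hV⟩ := hres j
    exact tadpole_stepProp_eq_zero_of_parity hr i ⟨_, _, C, δ, hδ, hV y ν y'⟩
      (parityOdd_add (trK_vertexOfK_eq_neg_sgnK_of_rows _ (hΦpar j y) ν y') (hΨpar j y ν y'))

end Tower

/-! ## §4 The literal of record: no parity hypothesis left -/

/-- [folklore] The zero remainder family is row-parity-odd (the literal of record: `RW = RW″ = 0`, `RB = RB″ = 0`, `RM = 0` — the hypotheses `hRW … hRM` of §3 are this lemma). -/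
theorem parityOdd_zero_family (y : Fin (d + 1) → ℤ) (κ : Fin (d + 1)) (u : Fin (d + 1) → ℤ) :
    trK ((fun (_ : Fin (d + 1) → ℤ) (_ : Fin (d + 1)) (_ : Fin (d + 1) → ℤ) => (0 : MKer (d + 1) (Fib d))) y κ u)
      = -sgnK ((fun (_ : Fin (d + 1) → ℤ) (_ : Fin (d + 1)) (_ : Fin (d + 1) → ℤ) => (0 : MKer (d + 1) (Fib d))) y κ u) :=
  parityOdd_zero

/-- [folklore] … and the levelled zero family. -/
theorem parityOdd_zero_family' (j : ℕ) (y : Fin (d + 1) → ℤ) (κ : Fin (d + 1)) (u : Fin (d + 1) → ℤ) :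
    trK ((fun (_ : ℕ) (_ : Fin (d + 1) → ℤ) (_ : Fin (d + 1)) (_ : Fin (d + 1) → ℤ) => (0 : MKer (d + 1) (Fib d))) j y κ u)
      = -sgnK ((fun (_ : ℕ) (_ : Fin (d + 1) → ℤ) (_ : Fin (d + 1)) (_ : Fin (d + 1) → ℤ) => (0 : MKer (d + 1) (Fib d))) j y κ u) :=
  parityOdd_zero


/-! ## §5 The parity split of the block Ward law: the EVEN half of the W-table obeys the EXACT identity, the residual is the divergence of the ODD half -/

/-- [folklore] **THE TWO HALVES OF A LETTER `L = C + R` WITH `C` PARITY-EVEN AND `R` PARITY-ODD**: `L + sgnK (trK L) = 2 • C` and `L − sgnK (trK L) = 2 • R` (the D1 lane's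
`WardLocusParitySplit.evenHalf_law_of_letter`, both halves). -/
theorem halves_of_letter {L C R : MKer (d + 1) (Fib d)} (hC : trK C = sgnK C) (hR : trK R = -sgnK R) (h : L = C + R) :
    L + sgnK (trK L) = (2 : ℝ) • C ∧ L - sgnK (trK L) = (2 : ℝ) • R := by
  have hP : sgnK (trK L) = C - R := by
    rw [h, trK_add, hC, hR, sgnK_add, sgnK_neg, sgnK_sgnK, sgnK_sgnK, sub_eq_add_neg]
  rw [hP, h, two_smul, two_smul]
  constructor <;> abel

/-- [folklore] **THE PARITY INVOLUTION COMMUTES WITH THE PURE-GAUGE SLICE `divW`** (a finite sum of differences over the slot index). -/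
theorem sgnK_trK_divW (V : Fin (d + 1) → (Fin (d + 1) → ℤ) → Fin (d + 1) → (Fin (d + 1) → ℤ) → MKer (d + 1) (Fib d))
    (y : Fin (d + 1) → ℤ) (ν : Fin (d + 1)) (y' : Fin (d + 1) → ℤ) :
    sgnK (trK (divW V y ν y')) = divW (fun μ u ν' w => sgnK (trK (V μ u ν' w))) y ν y' := by
  funext x z a b
  simp only [KernelWard.divW, sgnK_apply, trK_apply, Finset.sum_apply, Pi.sub_apply, Finset.mul_sum, mul_sub]

/-- [folklore] **`divW` OF THE EVEN ∕ ODD HALF IS THE EVEN ∕ ODD HALF OF `divW`.** -/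
theorem divW_half (V : Fin (d + 1) → (Fin (d + 1) → ℤ) → Fin (d + 1) → (Fin (d + 1) → ℤ) → MKer (d + 1) (Fib d)) (ε : ℝ)
    (y : Fin (d + 1) → ℤ) (ν : Fin (d + 1)) (y' : Fin (d + 1) → ℤ) :
    divW (fun μ u ν' w => (1 / 2 : ℝ) • (V μ u ν' w + ε • sgnK (trK (V μ u ν' w)))) y ν y'
      = (1 / 2 : ℝ) • (divW V y ν y' + ε • sgnK (trK (divW V y ν y'))) := by
  rw [sgnK_trK_divW]
  funext x z a b
  simp only [KernelWard.divW, Finset.sum_apply, Pi.sub_apply, Pi.add_apply, Pi.smul_apply, smul_eq_mul, Finset.mul_sum, ← Finset.sum_add_distrib]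
  refine Finset.sum_congr rfl fun μ _ => ?_
  ring

section Split

variable {Lc : ℕ} [NeZero Lc]

/-- NOT IN PRINT; OUR BOOKKEEPING.  **THE PARITY SPLIT OF THE BLOCK WARD LAW OF THE W-TABLE** (in-block root, any `cΛ`, ANY level-indexed pair table `W` obeying the (LAW) of
`WardResidualSRecursionAll.exists_kernelLaws_vertexForm` — the literal `W j = WrecAt … j` — with `Φ Ψ` parity-odd, i.e. §3 (a)(b)):
(a) the identity's MAIN TERM `conjV (dM G_j Lc S_j M_j e) (X_y)` is parity-EVEN (`parityEven_conjV_diagK_of_odd` ⨾ `parityOdd_dM`);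
(b) **THE EVEN HALF `W^{ev} := ½(W + sgnK∘trK∘W)` OBEYS THE EXACT BLOCK WARD IDENTITY**: `divW (W^{ev} j) y e = conjV (dM G_j Lc S_j M_j e) (X_y)` — NO RESIDUAL;
(c) **THE WARD-LOCUS RESIDUAL IS THE PURE-GAUGE SLICE OF THE ODD HALF**: `divW (W^{od} j) y e = vertexOfK G_j Lc (Φ j y) e + Ψ j y e`, `W^{od} := ½(W − sgnK∘trK∘W)` — the half the D1
consumer is blind to (OWNER g33 `WSlotParityBlind`).  So the (Q-R) object of route «WC-TL» constrains ONLY the parity-odd half of the W-table; the parity-even half is Ward-EXACT.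
Whether «T2Shape» ∕ «T2Drift» for `W^{ev}` then follow from the SLAVE class WITHOUT any (Q-R) row is the OWNER's ∕ an2's (IR-α0′) — NOT claimed here. -/
theorem ward_law_parity_split (hLc : 1 ≤ Lc) {r : Fin (d + 1) → ℕ} (hr : r ∈ box (d + 1) Lc) (cΛ : ℝ)
    {Φ Ψ : ℕ → (Fin (d + 1) → ℤ) → Fin (d + 1) → (Fin (d + 1) → ℤ) → MKer (d + 1) (Fib d)}
    (hΨpar : ∀ (j : ℕ) (y : Fin (d + 1) → ℤ) (ν : Fin (d + 1)) (y' : Fin (d + 1) → ℤ), trK (Ψ j y ν y') = -sgnK (Ψ j y ν y'))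
    (hΦpar : ∀ (j : ℕ) (Y : Fin (d + 1) → ℤ) (κ : Fin (d + 1)) (u : Fin (d + 1) → ℤ), trK (Φ j Y κ u) = -sgnK (Φ j Y κ u))
    {W : ℕ → Fin (d + 1) → (Fin (d + 1) → ℤ) → Fin (d + 1) → (Fin (d + 1) → ℤ) → MKer (d + 1) (Fib d)}
    (hlaw : ∀ (j : ℕ) (y : Fin (d + 1) → ℤ) (ν : Fin (d + 1)) (y' : Fin (d + 1) → ℤ),
      divW (W j) y ν y' = conjV (dM (coDressKBmAt (toSite r) Lc (KInvStep (d := d) Lc j)) Lc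
            (SpureRecAt d Lc (toSite r) ((Lc : ℝ) ^ (d + 1)) (-((Lc : ℝ) ^ (d + 1) * (1 / 2) * (Lc : ℝ) ^ (d + 1))) cΛ j)
            (M1At d Lc (toSite r) cΛ j) ν y')
          (diagK (((1 : ℝ) / 2) • ∑ v ∈ box (d + 1) Lc, legInd (toSite r) ((Lc : ℤ) • y + toSite v)))
        + (vertexOfK (coDressKBmAt (toSite r) Lc (KInvStep (d := d) Lc j)) Lc (Φ j y) ν y' + Ψ j y ν y')) :
    (∀ (j : ℕ) (y : Fin (d + 1) → ℤ) (ν : Fin (d + 1)) (y' : Fin (d + 1) → ℤ),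
      trK (conjV (dM (coDressKBmAt (toSite r) Lc (KInvStep (d := d) Lc j)) Lc
            (SpureRecAt d Lc (toSite r) ((Lc : ℝ) ^ (d + 1)) (-((Lc : ℝ) ^ (d + 1) * (1 / 2) * (Lc : ℝ) ^ (d + 1))) cΛ j)
            (M1At d Lc (toSite r) cΛ j) ν y')
          (diagK (((1 : ℝ) / 2) • ∑ v ∈ box (d + 1) Lc, legInd (toSite r) ((Lc : ℤ) • y + toSite v)))) = sgnK (conjV (dM (coDressKBmAt (toSite r) Lc (KInvStep (d := d) Lc j)) Lc
            (SpureRecAt d Lc (toSite r) ((Lc : ℝ) ^ (d + 1)) (-((Lc : ℝ) ^ (d + 1) * (1 / 2) * (Lc : ℝ) ^ (d + 1))) cΛ j)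
            (M1At d Lc (toSite r) cΛ j) ν y')
          (diagK (((1 : ℝ) / 2) • ∑ v ∈ box (d + 1) Lc, legInd (toSite r) ((Lc : ℤ) • y + toSite v))))) ∧
    (∀ (j : ℕ) (y : Fin (d + 1) → ℤ) (ν : Fin (d + 1)) (y' : Fin (d + 1) → ℤ),
      divW (fun μ u ν' w => (1 / 2 : ℝ) • (W j μ u ν' w + (1 : ℝ) • sgnK (trK (W j μ u ν' w)))) y ν y' = conjV (dM (coDressKBmAt (toSite r) Lc (KInvStep (d := d) Lc j)) Lc
            (SpureRecAt d Lc (toSite r) ((Lc : ℝ) ^ (d + 1)) (-((Lc : ℝ) ^ (d + 1) * (1 / 2) * (Lc : ℝ) ^ (d + 1))) cΛ j)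
            (M1At d Lc (toSite r) cΛ j) ν y')
          (diagK (((1 : ℝ) / 2) • ∑ v ∈ box (d + 1) Lc, legInd (toSite r) ((Lc : ℤ) • y + toSite v)))) ∧
    (∀ (j : ℕ) (y : Fin (d + 1) → ℤ) (ν : Fin (d + 1)) (y' : Fin (d + 1) → ℤ),
      divW (fun μ u ν' w => (1 / 2 : ℝ) • (W j μ u ν' w + (-1 : ℝ) • sgnK (trK (W j μ u ν' w)))) y ν y' = (vertexOfK (coDressKBmAt (toSite r) Lc (KInvStep (d := d) Lc j)) Lc (Φ j y) ν y' + Ψ j y ν y')) := by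
  have hC : ∀ (j : ℕ) (y : Fin (d + 1) → ℤ) (ν : Fin (d + 1)) (y' : Fin (d + 1) → ℤ), trK (conjV (dM (coDressKBmAt (toSite r) Lc (KInvStep (d := d) Lc j)) Lc
            (SpureRecAt d Lc (toSite r) ((Lc : ℝ) ^ (d + 1)) (-((Lc : ℝ) ^ (d + 1) * (1 / 2) * (Lc : ℝ) ^ (d + 1))) cΛ j)
            (M1At d Lc (toSite r) cΛ j) ν y')
          (diagK (((1 : ℝ) / 2) • ∑ v ∈ box (d + 1) Lc, legInd (toSite r) ((Lc : ℤ) • y + toSite v)))) = sgnK (conjV (dM (coDressKBmAt (toSite r) Lc (KInvStep (d := d) Lc j)) Lc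
            (SpureRecAt d Lc (toSite r) ((Lc : ℝ) ^ (d + 1)) (-((Lc : ℝ) ^ (d + 1) * (1 / 2) * (Lc : ℝ) ^ (d + 1))) cΛ j)
            (M1At d Lc (toSite r) cΛ j) ν y')
          (diagK (((1 : ℝ) / 2) • ∑ v ∈ box (d + 1) Lc, legInd (toSite r) ((Lc : ℤ) • y + toSite v)))) := fun j y ν y' =>
    parityEven_conjV_diagK_of_odd _ (parityOdd_dM _ Lc
      (trK_SpureRecAt (d := d) hLc hr ((Lc : ℝ) ^ (d + 1)) (-((Lc : ℝ) ^ (d + 1) * (1 / 2) * (Lc : ℝ) ^ (d + 1))) cΛ j)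
      (fun ρ w => trK_M1At (toSite r) cΛ j ρ w) ν y')
  have hR : ∀ (j : ℕ) (y : Fin (d + 1) → ℤ) (ν : Fin (d + 1)) (y' : Fin (d + 1) → ℤ), trK (vertexOfK (coDressKBmAt (toSite r) Lc (KInvStep (d := d) Lc j)) Lc (Φ j y) ν y' + Ψ j y ν y') = -sgnK (vertexOfK (coDressKBmAt (toSite r) Lc (KInvStep (d := d) Lc j)) Lc (Φ j y) ν y' + Ψ j y ν y') := fun j y ν y' =>
    parityOdd_add (trK_vertexOfK_eq_neg_sgnK_of_rows _ (hΦpar j y) ν y') (hΨpar j y ν y')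
  refine ⟨hC, fun j y ν y' => ?_, fun j y ν y' => ?_⟩
  · rw [divW_half, one_smul, (halves_of_letter (hC j y ν y') (hR j y ν y') (hlaw j y ν y')).1, smul_smul]
    norm_num
  · rw [divW_half, neg_one_smul, ← sub_eq_add_neg, (halves_of_letter (hC j y ν y') (hR j y ν y') (hlaw j y ν y')).2, smul_smul]
    norm_num

end Split

end Summit.QuantumFields.BalabanUV.Beta.GAN24.WardResidualParity

end
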